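import Mathlib
import HarnessLib

/-!
# Characteristic functions along a weakly convergent sequence converge UNIFORMLY ON BOUNDED
# SETS of arguments — the equicontinuity lemma behind limits of statistics with deterministic,
# non-convergent rescalings (unequal sample sizes)

HONEST FRAMING: exact (Metropolis-corrected) sampling algorithms for lattice gauge theory;
figures of merit are autocorrelation/cost numbers at stated couplings and volumes; no
continuum-physics claim.

Venture `LatticeQCDFlow` (cell pub-lqcd), topic `Scoring`; FANOUT row 4 (`s0-u1-b`, rung S0-B:
two independent codes compared column by column, "A vs B within `1σ_comb`").  The two-code
agreement statistic with UNEQUAL sample sizes `n_A ≠ n_B` is a combination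
`aₙ·Uₙ − bₙ·Wₙ` of two independent, asymptotically normal columns with DETERMINISTIC
coefficients `aₙ, bₙ` that are bounded but need not converge (the ratio `n_A/n_B` is free).  Its
characteristic function at `t` is `φ_{Uₙ}(aₙt)·φ_{Wₙ}(−bₙt)`, so what is needed is convergence
of characteristic functions ALONG BOUNDED, MOVING ARGUMENTS.  Lévy's theorem
(`ProbabilityMeasure.tendsto_iff_tendsto_charFun`) gives pointwise convergence only; this file
upgrades it: a weakly convergent sequence is tight (`isTightMeasureSet_of_tendsto_charFun`),
tightness makes the characteristic functions EQUI-continuous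
(**`norm_charFun_sub_charFun_le`**: `‖φ_μ(s) − φ_μ(t)‖ ≤ |s − t|·R + 2·μ{|x| > R}`, `R ≥ 0`),
hence `φ_{μₙ}(uₙ) → φ_μ(a)` whenever `μₙ ⇒ μ` and `uₙ → a`
(**`tendsto_charFun_apply_of_tendsto`**, joint continuity), and by Bolzano–Weierstrass plus the
subsequence principle `φ_{μₙ}(uₙ) − φ_μ(uₙ) → 0` for every BOUNDED sequence of arguments
(**`tendsto_charFun_sub_charFun_of_abs_le`**; random-variable forms
**`tendsto_charFun_map_of_tendstoInDistribution`**,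
**`tendsto_charFun_map_sub_of_tendstoInDistribution`**).  NEW WORK of the cell (a classical
fact — uniform convergence of characteristic functions on compacts under weak convergence —
not in Mathlib); no definition; nothing cited as a fact.

## Content

* `norm_cexp_sub_cexp_le` — `‖e^{isx} − e^{itx}‖ ≤ |s − t|·|x|`;
* **`norm_charFun_sub_charFun_le`** — the equicontinuity bound;
* **`tendsto_charFun_apply_of_tendsto`** — `μₙ ⇒ μ`, `uₙ → a` ⇒ `φ_{μₙ}(uₙ) → φ_μ(a)`;
* **`tendsto_charFun_sub_charFun_of_abs_le`** — `μₙ ⇒ μ`, `|uₙ| ≤ B` ⇒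
  `φ_{μₙ}(uₙ) − φ_μ(uₙ) → 0`;
* `tendsto_charFun_map_of_tendstoInDistribution`,
  `tendsto_charFun_map_sub_of_tendstoInDistribution` — the same for `Xₙ ⇒ Z`.

NOT CLAIMED: a `TendstoUniformlyOn` statement on compacts (the sequential form is what is
used downstream); vector-valued arguments; rates.
-/

noncomputable section

namespace Summit.Ventures.LatticeQCDFlow.Scoring.CardConsistency

open MeasureTheory ProbabilityTheory Filter Complex
open scoped Topology

/-! ## §1 The equicontinuity bound -/

section Bound

/-- `‖e^{isx} − e^{itx}‖ ≤ |s − t|·|x|` for real `s, t, x`. [folklore] -/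
theorem norm_cexp_sub_cexp_le (s t x : ℝ) :
    ‖cexp ((s : ℂ) * x * I) - cexp ((t : ℂ) * x * I)‖ ≤ |s - t| * |x| := by
  have e : cexp ((s : ℂ) * x * I) - cexp ((t : ℂ) * x * I)
      = cexp ((t : ℂ) * x * I) * (cexp (I * (((s - t) * x : ℝ) : ℂ)) - 1) := by
    rw [mul_sub, mul_one, ← Complex.exp_add]
    have harg : (s : ℂ) * x * I = (t : ℂ) * x * I + I * (((s - t) * x : ℝ) : ℂ) := by
      push_cast
      ring
    rw [harg]
  have h1 : ‖cexp ((t : ℂ) * x * I)‖ = 1 := by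
    rw [show (t : ℂ) * x * I = ((t * x : ℝ) : ℂ) * I by push_cast; ring]
    exact Complex.norm_exp_ofReal_mul_I _
  rw [e, norm_mul, h1, one_mul]
  refine (Real.norm_exp_I_mul_ofReal_sub_one_le).trans ?_
  rw [Real.norm_eq_abs, abs_mul]

/-- `x ↦ e^{iux}` is integrable against a probability measure on `ℝ` (the integrand has norm
one: Mathlib's `Complex.norm_exp_ofReal_mul_I`). [folklore] -/
theorem integrable_cexp_mul_I (μ : Measure ℝ) [IsProbabilityMeasure μ] (u : ℝ) :
    Integrable (fun x : ℝ => cexp ((u : ℂ) * x * I)) μ := by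
  refine Integrable.of_bound (by fun_prop) 1 (ae_of_all _ fun x => ?_)
  rw [show (u : ℂ) * x * I = ((u * x : ℝ) : ℂ) * I by push_cast; ring]
  exact (Complex.norm_exp_ofReal_mul_I _).le

/-- **EQUICONTINUITY OF CHARACTERISTIC FUNCTIONS FROM A TAIL BOUND.**  For a probability
measure `μ` on `ℝ`, reals `s, t` and `R ≥ 0`:
`‖φ_μ(s) − φ_μ(t)‖ ≤ |s − t|·R + 2·μ{x : R < |x|}`. [ours] (split the integrand
`e^{isx} − e^{itx}` on `{|x| ≤ R}`, where it is at most `|s − t|·R`, and its complement, where it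
is at most `2`) -/
theorem norm_charFun_sub_charFun_le (μ : Measure ℝ) [IsProbabilityMeasure μ] (s t : ℝ) {R : ℝ}
    (hR : 0 ≤ R) :
    ‖charFun μ s - charFun μ t‖ ≤ |s - t| * R + 2 * μ.real {x : ℝ | R < |x|} := by
  rw [charFun_apply_real, charFun_apply_real,
    ← integral_sub (integrable_cexp_mul_I μ s) (integrable_cexp_mul_I μ t)]
  refine (norm_integral_le_integral_norm _).trans ?_
  have hS : MeasurableSet {x : ℝ | R < |x|} :=
    measurableSet_lt measurable_const continuous_abs.measurable
  have hdom : ∀ x : ℝ, ‖cexp ((s : ℂ) * x * I) - cexp ((t : ℂ) * x * I)‖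
      ≤ |s - t| * R + {x : ℝ | R < |x|}.indicator (fun _ => (2 : ℝ)) x := by
    intro x
    have h1 : ∀ u : ℝ, ‖cexp ((u : ℂ) * x * I)‖ = 1 := fun u => by
      rw [show (u : ℂ) * x * I = ((u * x : ℝ) : ℂ) * I by push_cast; ring]
      exact Complex.norm_exp_ofReal_mul_I _
    by_cases hx : R < |x|
    · rw [Set.indicator_of_mem (show x ∈ {x : ℝ | R < |x|} from hx)]
      calc ‖cexp ((s : ℂ) * x * I) - cexp ((t : ℂ) * x * I)‖
          ≤ ‖cexp ((s : ℂ) * x * I)‖ + ‖cexp ((t : ℂ) * x * I)‖ := norm_sub_le _ _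
        _ = 2 := by rw [h1 s, h1 t]; norm_num
        _ ≤ |s - t| * R + 2 := by nlinarith [abs_nonneg (s - t)]
    · rw [Set.indicator_of_notMem (show x ∉ {x : ℝ | R < |x|} from hx), add_zero]
      push Not at hx
      exact (norm_cexp_sub_cexp_le s t x).trans (mul_le_mul_of_nonneg_left hx (abs_nonneg _))
  calc ∫ x, ‖cexp ((s : ℂ) * x * I) - cexp ((t : ℂ) * x * I)‖ ∂μ
      ≤ ∫ x, (|s - t| * R + {x : ℝ | R < |x|}.indicator (fun _ => (2 : ℝ)) x) ∂μ := by
        refine integral_mono ((integrable_cexp_mul_I μ s).sub (integrable_cexp_mul_I μ t)).norm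
          ?_ hdom
        exact (integrable_const _).add ((integrable_const _).indicator hS)
    _ = |s - t| * R + 2 * μ.real {x : ℝ | R < |x|} := by
        rw [integral_add (integrable_const _) ((integrable_const _).indicator hS),
          integral_indicator_const _ hS, integral_const]
        simp only [smul_eq_mul, probReal_univ, one_mul]
        ring

end Bound

/-! ## §2 Joint continuity and convergence along bounded arguments -/

section Sequences

variable {μs : ℕ → ProbabilityMeasure ℝ} {μ : ProbabilityMeasure ℝ}

/-- **JOINT CONTINUITY**: if `μₙ ⇒ μ` weakly (probability measures on `ℝ`) and `uₙ → a`, then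
`φ_{μₙ}(uₙ) → φ_μ(a)`. [ours] (tightness of a convergent sequence — Mathlib's
`isTightMeasureSet_of_tendsto_charFun` — feeds `norm_charFun_sub_charFun_le`, giving
`φ_{μₙ}(uₙ) − φ_{μₙ}(a) → 0`; Lévy's theorem gives `φ_{μₙ}(a) → φ_μ(a)`) -/
theorem tendsto_charFun_apply_of_tendsto (h : Tendsto μs atTop (𝓝 μ)) {u : ℕ → ℝ} {a : ℝ}
    (hu : Tendsto u atTop (𝓝 a)) :
    Tendsto (fun n => charFun (μs n : Measure ℝ) (u n)) atTop (𝓝 (charFun (μ : Measure ℝ) a)) := by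
  have hpt : ∀ t : ℝ, Tendsto (fun n => charFun (μs n : Measure ℝ) t) atTop
      (𝓝 (charFun (μ : Measure ℝ) t)) :=
    ProbabilityMeasure.tendsto_iff_tendsto_charFun.1 h
  have htight : IsTightMeasureSet (Set.range fun n => (μs n : Measure ℝ)) :=
    isTightMeasureSet_of_tendsto_charFun (μ := fun n => (μs n : Measure ℝ))
      (continuous_charFun (μ := (μ : Measure ℝ))).continuousAt hpt
  -- `φ_{μₙ}(uₙ) − φ_{μₙ}(a) → 0`
  have hdiff : Tendsto (fun n => charFun (μs n : Measure ℝ) (u n) - charFun (μs n : Measure ℝ) a)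
      atTop (𝓝 0) := by
    rw [NormedAddGroup.tendsto_nhds_zero]
    intro ε hε
    obtain ⟨K, hK, hKμ⟩ := isTightMeasureSet_iff_exists_isCompact_measure_compl_le.1 htight
      (ENNReal.ofReal (ε / 4)) (ENNReal.ofReal_pos.2 (by positivity))
    obtain ⟨R₀, hR₀⟩ := hK.isBounded.subset_closedBall 0
    have hR : 0 ≤ max R₀ 0 := le_max_right _ _
    have htail : ∀ n, (μs n : Measure ℝ).real {x : ℝ | max R₀ 0 < |x|} ≤ ε / 4 := by
      intro n
      have hsub : {x : ℝ | max R₀ 0 < |x|} ⊆ Kᶜ := by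
        intro x hx hxK
        have hx' := hR₀ hxK
        rw [Metric.mem_closedBall, dist_zero_right, Real.norm_eq_abs] at hx'
        exact (not_le.2 hx) (hx'.trans (le_max_left _ _))
      calc (μs n : Measure ℝ).real {x : ℝ | max R₀ 0 < |x|} ≤ (μs n : Measure ℝ).real Kᶜ :=
            measureReal_mono hsub
        _ ≤ ε / 4 := by
            rw [measureReal_def]
            exact ENNReal.toReal_le_of_le_ofReal (by positivity) (hKμ _ ⟨n, rfl⟩)
    have h0 : Tendsto (fun n => |u n - a| * max R₀ 0) atTop (𝓝 0) := by
      have h' := ((hu.sub_const a).abs).mul_const (max R₀ 0)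
      simpa using h'
    filter_upwards [h0.eventually_lt_const (by positivity : (0 : ℝ) < ε / 2)] with n hn
    calc ‖charFun (μs n : Measure ℝ) (u n) - charFun (μs n : Measure ℝ) a‖
        ≤ |u n - a| * max R₀ 0 + 2 * (μs n : Measure ℝ).real {x : ℝ | max R₀ 0 < |x|} :=
          norm_charFun_sub_charFun_le _ _ _ hR
      _ < ε := by linarith [htail n]
  have hsum := hdiff.add (hpt a)
  simpa using hsum

/-- **CONVERGENCE ALONG BOUNDED ARGUMENTS**: if `μₙ ⇒ μ` weakly and `|uₙ| ≤ B` for all `n`,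
then `φ_{μₙ}(uₙ) − φ_μ(uₙ) → 0`. [ours] (subsequence principle: along a Bolzano–Weierstrass
subsequence `u → a`, both terms tend to `φ_μ(a)` by `tendsto_charFun_apply_of_tendsto` and
the continuity of `φ_μ`) -/
theorem tendsto_charFun_sub_charFun_of_abs_le (h : Tendsto μs atTop (𝓝 μ)) {u : ℕ → ℝ}
    {B : ℝ} (hu : ∀ n, |u n| ≤ B) :
    Tendsto (fun n => charFun (μs n : Measure ℝ) (u n) - charFun (μ : Measure ℝ) (u n))
      atTop (𝓝 0) := by
  refine tendsto_of_subseq_tendsto fun ns hns => ?_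
  obtain ⟨a, -, φ, hφ, hlim⟩ := tendsto_subseq_of_bounded (Metric.isBounded_Icc (-B) B)
    (x := u ∘ ns) (fun n => ⟨(abs_le.1 (hu (ns n))).1, (abs_le.1 (hu (ns n))).2⟩)
  refine ⟨φ, ?_⟩
  have hlim' : Tendsto (fun n => u (ns (φ n))) atTop (𝓝 a) := hlim
  have h1 : Tendsto (fun n => charFun (μs (ns (φ n)) : Measure ℝ) (u (ns (φ n)))) atTop
      (𝓝 (charFun (μ : Measure ℝ) a)) :=
    tendsto_charFun_apply_of_tendsto (μs := fun n => μs (ns (φ n)))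
      (h.comp (hns.comp hφ.tendsto_atTop)) hlim'
  have h2 : Tendsto (fun n => charFun (μ : Measure ℝ) (u (ns (φ n)))) atTop
      (𝓝 (charFun (μ : Measure ℝ) a)) :=
    ((continuous_charFun (μ := (μ : Measure ℝ))).tendsto a).comp hlim'
  have h12 := h1.sub h2
  simpa using h12

end Sequences

/-! ## §3 Random-variable forms -/

section RandomVariables

variable {Ω : Type*} [MeasurableSpace Ω] {P : Measure Ω} [IsProbabilityMeasure P]
variable {Ω' : Type*} [MeasurableSpace Ω'] {P' : Measure Ω'} [IsProbabilityMeasure P']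

/-- **`Xₙ ⇒ Z` and `uₙ → a` ⇒ `φ_{Xₙ}(uₙ) → φ_Z(a)`** for real statistics. [ours] -/
theorem tendsto_charFun_map_of_tendstoInDistribution {X : ℕ → Ω → ℝ} {Z : Ω' → ℝ}
    (hX : TendstoInDistribution X atTop Z (fun _ => P) P') {u : ℕ → ℝ} {a : ℝ}
    (hu : Tendsto u atTop (𝓝 a)) :
    Tendsto (fun n => charFun (P.map (X n)) (u n)) atTop (𝓝 (charFun (P'.map Z) a)) := by
  have h := tendsto_charFun_apply_of_tendsto hX.tendsto hu
  simpa only [ProbabilityMeasure.coe_mk] using h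

/-- **`Xₙ ⇒ Z` and `|uₙ| ≤ B` ⇒ `φ_{Xₙ}(uₙ) − φ_Z(uₙ) → 0`** for real statistics: the
characteristic functions converge uniformly along bounded arguments. [ours] -/
theorem tendsto_charFun_map_sub_of_tendstoInDistribution {X : ℕ → Ω → ℝ} {Z : Ω' → ℝ}
    (hX : TendstoInDistribution X atTop Z (fun _ => P) P') {u : ℕ → ℝ} {B : ℝ}
    (hu : ∀ n, |u n| ≤ B) :
    Tendsto (fun n => charFun (P.map (X n)) (u n) - charFun (P'.map Z) (u n)) atTop (𝓝 0) := by
  have h := tendsto_charFun_sub_charFun_of_abs_le hX.tendsto hu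
  simpa only [ProbabilityMeasure.coe_mk] using h

end RandomVariables

end Summit.Ventures.LatticeQCDFlow.Scoring.CardConsistency

end
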